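import Summits.QuantumFields.BalabanUV.T4Continuum.Spine.NE7.Targets

/-!
# BalabanUVNodes ∕ N20·N19′ (NE7b · NE7 core) — NO DIAL RESCUES THE CORE EDGE: at a two-run reading whose log-ratio `log(B_τ ∕ A_τ)` is D-QUANTISED along an integer
# class label (Q) and whose label is ANTI-CONCENTRATED under the run-A weights (ACn), frequently in `K`, NO bad class `Bad`, NO weights `W`, NO shell split `shA ∕ shB`,
# NO shell weights `Wsh` and NO rate `δ` give `RelWeightBound ∧ ShellWeightBound ∧ NE7.Core ∧ Summable δ` — the «+ shells ∕ + booking» closure of the crux card's caricature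

Cell `pub-ymgap`, YM-PLAN Track A (HUMAN RULING D-0062; D-0149 ∕ D-0154, director-ym R399 (3a)); width seat `pub-ymgap-dag-n20-w5` (g0) on node N20 = NE7b; key item K3⁷
`SpineGivenEndpointR13SepCoPH` = stmt-QuantumFields-20544 (`--kind proof --supports 20544 --as helper`); COUNT-NEUTRAL.  Bus: CLAIM-1 ∕ INTENT-1 (pub-ymgap INBOX l.29068).
[III] = [Balaban1988Convergent] (CMP 119), [LF-II] = [Balaban1989LargeFieldII] (CMP 122), [K] = [King1986] (CMP 103) — LOCATION only, nothing printed is used.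

WHY.  The crux card `window-key-core` (ym-nodeO idea-3 g8, `Cruxes/SpineGivenEndpointR13SepCoPH/Ideas/window-key-core.md` on 20544) diagnoses K3⁷ v5's stub 2 (`stub_expansion13H`:
`∃ jc sh cr, PinnedAtLive jc sh cr ∧ KeyedRelWeight cr ∧ KeyedShellWeight cr ∧ KeyedExtraction cr ∧ KeyedCoreEdgeHolderD4 β cr rr`) as REFUTABLE AT ITS PIN under two located rows:
(N)∕(XG) «at the full-history key the two-run vacuum log-ratio of a class is additive over its old large-field blocks with a per-block contrast `D₀ ≠ 0`» and (SAT) «first-level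
saturation: the old-block count of a typical class tends to infinity» (dag-n20-w1 `…N20KeyedRelWeightPolicyWall` p597932, displayed; toy `…N20FirstLevelSaturationToy` p605682).
Its kernel caricature (`WindowKeyCoreSketch.lean` §1 `caricature_not_coreEdge`) takes `Bad := ∅` and NO shells, and dag-n19-w1's guard `N19HybridBeyondTarget.not_coreEdge_of_unsummable_gap`
(p602850 §6) needs two classes KNOWN to be good at ONE reading — so CRIT-1's triage (INBOX l.28908, (2)) books the diagnosis as CONDITIONAL: «(XG) undecided ∧ the SHELL DIAL
`sh` not closed (caricature has no shells) … cdisprove decides (XG) + shells».  THIS FILE closes the «+ shells» (and «+ booking») half at the structural level: the prover's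
dials — which classes to book, how much of each term to shave into shells, which constant, which rate — are quantified UNIVERSALLY, and the obstruction is reduced to the two
displayed rows (Q) ∧ (ACn) on the reading's weights ALONE.  Whether the record's `weightA₁₃ ∕ weightB₁₃` satisfy them is NOT decided here: (Q) with `D ≠ 0` is (XG) — an
ANALYTIC property of def-T's step kernels inside `Node00.classWeightOfDatum₉` — and (ACn) is (SAT)'s mechanism; the companion `…N20QuantisedRatioNoRescueAtRecord` books the
consequence AT dag-n20-d's reading of record `crOfRecord₁₃VAt` BY NAME.

MECHANISM ([folklore]).  (i) THE BINDERS PAY THE MISFIT (§1): on a good class `e^{c−r}(A − shA) ≤ B − shB ≤ e^{c+r}(A − shA)` with `0 ≤ sh` gives `(B − e^{c+r}A)⁺ ≤ shB`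
and `(e^{c−r}A − B)⁺ ≤ e^{c−r}·shA`; on a bad class the misfit is `≤ B + e^{c−r}A`; so `Σ_T misfit(c, r) ≤ (W_K + Wsh_K)·(Σ_T B + e^{c−r}Σ_T A)` (`r = |vol·δ_K|`).  (ii) THE
MISFIT IS LARGE (§2): under (Q) the log-ratios sit within `ε` of the lattice `c₀ + D·ℤ`; a window of radius `r + ε + D∕4 < D∕2` around ANY centre meets ONE level
(`label_eq_of_window`), carrying `≤ m·Σ_T A` by (ACn); every other class pays at least the fraction `1 − e^{−D∕4}` of its `B` (above) or of `e^{c−r}A` (below): `Σ_T misfit ≥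
(1 − e^{−D∕4})(1 − m(1 + e^{3D∕4}))∕2 · (Σ_T B + e^{c−r}Σ_T A)`.  (iii) (§3) `Summable δ, W, Wsh` make `r_K → 0` and `W_K + Wsh_K → 0`, so at a late `K` where (Q) ∧ (ACn)
hold, `¼(1 − e^{−D∕4}) ≤ W_K + Wsh_K < ¼(1 − e^{−D∕4})`.  NO `W + Wsh < 1` clause is used (dag-n19-w1 `…N19EventualBinderList` p605733: never the obstruction); it is the
WEIGHTED MISFIT (an L¹ deviation from the best constant), not the class oscillation, that shells and booking cannot pay.

CONTENTS.  §1 `posPart_upper_le_shell` · `posPart_lower_le_shell` · `misfit_le_terms` · `sandwich_abs` · ★ `sum_misfit_le_of_faces`;  §2 `label_eq_of_window` ·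
`sum_window_le_of_antiConc` · `pointwise_lower` · ★ `sum_misfit_ge_of_quantised_antiConc`;  §3 ★★ `not_coreEdge_of_quantised_antiConc` (∀ `Bad W shA shB Wsh`: no `δ`) ·
★★ `not_hybridNE7_of_quantised_antiConc` · `core_of_classConstant_ratio` (the `D = 0` control);  §4 A6 non-vacuity on the uniform-label toy (`ι = ℕ`, `T K = range (n K + 1)`,
`A ≡ 1`, `B = e^{D·label}`, `n_K → ∞`): `toy_quantised` · `toy_antiConc` · ★ `not_hybridNE7_toy` (hypotheses jointly inhabited, conclusion bites) · `hybridNE7_toy_unquantised`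
(the same toy at `D = 0` carries `HybridNE7` trivially — the quantum `D` is the whole obstruction).

HONEST FRAMING.  [folklore] finite-sum ∕ real-analysis bookkeeping over the tree's SHAPES `T4WeightBudget.RelWeightBound` · `T4IndicatorShell.ShellWeightBound` · `Spine.NE7.Core` ·
`T4MatchingAssembly.HybridNE7`; (Q) and (ACn) are DISPLAYED HYPOTHESES — NOT asserted for Bałaban's objects, NOT decided at the record; proves NO estimate; refutes NO registered
stub (a conditional diagnosis in kernel form, CRIT-1's word); nothing of Bałaban's asserted; NE7 ∕ NE7b ∕ NE7c NOT PRINTED for d = 4, NOT proved; N19 ∕ N20 ∕ N21 NOT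
discharged; K3⁷ OPEN; counts UNMOVED (typed 28∕28 · discharged 5∕27, A 5∕28); no count claim; no summit statement is proved by this seat; one finite 𝕋⁴ programme at fixed ε,
Bałaban AS PRINTED — R4 closes the conditional rung `BalabanLadder.UV` only; the YM mass gap (Clay) is NOT proved by any of this; NOT ℝ⁴, NOT OS.  No `def`, no `instance`, no
`notation`, no `sorry`.  Sources (location only): [III] (2.18) p.257; [LF-II] (1.79)–(1.80) pp.383–384; [K] (3.10)–(3.13) pp.656–657.
-/

noncomputable section

open Finset Real
open _root_.Filter _root_.Topology

namespace Summit.QuantumFields.YangMills.BalabanUVNodes.N20QuantisedRatioNoRescue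

open Literature.MathematicalPhysics.QuantumFieldTheory.Balaban1983to89
open Literature.MathematicalPhysics.QuantumFieldTheory.Balaban1983to89.T4WeightBudget (RelWeightBound)
open Literature.MathematicalPhysics.QuantumFieldTheory.Balaban1983to89.T4IndicatorShell (ShellWeightBound)
open Literature.MathematicalPhysics.QuantumFieldTheory.Balaban1983to89.T4MatchingAssembly (HybridNE7)
open Summit.QuantumFields.BalabanUV.T4Continuum.Spine.NE7 (Core)

/-! ## §1  The hybrid binders PAY the two-sided misfit `(B − e^{c+r}A)⁺ + (e^{c−r}A − B)⁺` -/

section Misfit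

variable {a b sa sb c r : ℝ}

/-- [folklore] On a good class the UPPER misfit is paid by run B's shell: `B − shB ≤ e^{c+r}(A − shA)`, `0 ≤ shA` ⇒ `(B − e^{c+r}A)⁺ ≤ shB`. -/
theorem posPart_upper_le_shell (h : b - sb ≤ exp (c + r) * (a - sa)) (hsa : 0 ≤ sa) (hsb : 0 ≤ sb) :
    max (b - exp (c + r) * a) 0 ≤ sb := by
  refine max_le ?_ hsb
  have : 0 ≤ exp (c + r) * sa := mul_nonneg (exp_pos _).le hsa
  nlinarith

/-- [folklore] On a good class the LOWER misfit is paid by run A's shell: `e^{c−r}(A − shA) ≤ B − shB`, `0 ≤ shB` ⇒ `(e^{c−r}A − B)⁺ ≤ e^{c−r}·shA`. -/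
theorem posPart_lower_le_shell (h : exp (c - r) * (a - sa) ≤ b - sb) (hsa : 0 ≤ sa) (hsb : 0 ≤ sb) :
    max (exp (c - r) * a - b) 0 ≤ exp (c - r) * sa := by
  refine max_le ?_ (mul_nonneg (exp_pos _).le hsa)
  nlinarith [mul_nonneg (exp_pos (c - r)).le hsa]

/-- [folklore] On ANY class with non-negative weights the misfit is at most `B + e^{c−r}A`. -/
theorem misfit_le_terms (ha : 0 ≤ a) (hb : 0 ≤ b) :
    max (b - exp (c + r) * a) 0 + max (exp (c - r) * a - b) 0 ≤ b + exp (c - r) * a := by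
  have h1 : max (b - exp (c + r) * a) 0 ≤ b := max_le (by nlinarith [mul_nonneg (exp_pos (c + r)).le ha]) hb
  have h2 : max (exp (c - r) * a - b) 0 ≤ exp (c - r) * a := max_le (by linarith) (mul_nonneg (exp_pos _).le ha)
  linarith

/-- [folklore] A two-sided sandwich with a SIGNED half-width `η` and a non-negative left core implies the sandwich with half-width `|η|`. -/
theorem sandwich_abs {p q η : ℝ} (hp : 0 ≤ p) (h : exp (c - η) * p ≤ q ∧ q ≤ exp (c + η) * p) :
    exp (c - |η|) * p ≤ q ∧ q ≤ exp (c + |η|) * p := by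
  obtain ⟨h1, h2⟩ := h
  constructor
  · calc exp (c - |η|) * p ≤ exp (c - η) * p :=
        mul_le_mul_of_nonneg_right (exp_le_exp.mpr (by linarith [le_abs_self η])) hp
      _ ≤ q := h1
  · calc q ≤ exp (c + η) * p := h2
      _ ≤ exp (c + |η|) * p := mul_le_mul_of_nonneg_right (exp_le_exp.mpr (by linarith [le_abs_self η])) hp

end Misfit
section Upper

variable {ι : Type*} [DecidableEq ι] {l₀ : ℝ} {T : ℕ → Finset ι} {A B shA shB : ℕ → ℝ → ι → ℝ}
  {Bad : ℕ → ℝ → Finset ι} {W Wsh : ℕ → ℝ}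

/-- ★ **THE BINDERS PAY THE MISFIT** [folklore]: at a level `K` and an admissible source `t`, if the bad class is booked (`RelWeightBound`), the shells are booked
(`ShellWeightBound`) and the good cores are sandwiched with constant `c` and half-width `r` (the `core` field of `HybridNE7` at `K`, half-width `|vol·δ_K|`), then the
total two-sided misfit of the FULL terms against the window `[e^{c−r}, e^{c+r}]` is at most `(W_K + Wsh_K)·(Σ_T B + e^{c−r}·Σ_T A)` (non-negative weights). -/
theorem sum_misfit_le_of_faces (hW : RelWeightBound l₀ T A B Bad W) (hSh : ShellWeightBound l₀ T A B shA shB Wsh)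
    {K : ℕ} {t : ℝ} (ht : |t| ≤ l₀) {c r : ℝ}
    (hcore : ∀ τ ∈ T K \ Bad K t, exp (c - r) * (A K t τ - shA K t τ) ≤ B K t τ - shB K t τ ∧ B K t τ - shB K t τ ≤ exp (c + r) * (A K t τ - shA K t τ))
    (hA : ∀ τ ∈ T K, 0 ≤ A K t τ) (hB : ∀ τ ∈ T K, 0 ≤ B K t τ) :
    ∑ τ ∈ T K, (max (B K t τ - exp (c + r) * A K t τ) 0 + max (exp (c - r) * A K t τ - B K t τ) 0) ≤
      (W K + Wsh K) * (∑ τ ∈ T K, B K t τ + exp (c - r) * ∑ τ ∈ T K, A K t τ) := by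
  have hsub : Bad K t ⊆ T K := hW.bad_subset K t ht
  rw [← Finset.sum_sdiff hsub]
  have hgood : ∑ τ ∈ T K \ Bad K t, (max (B K t τ - exp (c + r) * A K t τ) 0 + max (exp (c - r) * A K t τ - B K t τ) 0) ≤
      ∑ τ ∈ T K, (shB K t τ + exp (c - r) * shA K t τ) := by
    calc ∑ τ ∈ T K \ Bad K t, (max (B K t τ - exp (c + r) * A K t τ) 0 + max (exp (c - r) * A K t τ - B K t τ) 0)
        ≤ ∑ τ ∈ T K \ Bad K t, (shB K t τ + exp (c - r) * shA K t τ) := by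
          refine Finset.sum_le_sum fun τ hτ => ?_
          have hA0 := hSh.sh_nonneg_left K t ht τ (Finset.mem_sdiff.mp hτ).1
          have hB0 := hSh.sh_nonneg_right K t ht τ (Finset.mem_sdiff.mp hτ).1
          exact add_le_add (posPart_upper_le_shell (hcore τ hτ).2 hA0 hB0) (posPart_lower_le_shell (hcore τ hτ).1 hA0 hB0)
      _ ≤ ∑ τ ∈ T K, (shB K t τ + exp (c - r) * shA K t τ) :=
          Finset.sum_le_sum_of_subset_of_nonneg Finset.sdiff_subset fun τ hτ _ =>
            add_nonneg (hSh.sh_nonneg_right K t ht τ hτ) (mul_nonneg (exp_pos _).le (hSh.sh_nonneg_left K t ht τ hτ))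
  have hbad : ∑ τ ∈ Bad K t, (max (B K t τ - exp (c + r) * A K t τ) 0 + max (exp (c - r) * A K t τ - B K t τ) 0) ≤
      ∑ τ ∈ Bad K t, (B K t τ + exp (c - r) * A K t τ) :=
    Finset.sum_le_sum fun τ hτ => misfit_le_terms (hA τ (hsub hτ)) (hB τ (hsub hτ))
  have hshell : ∑ τ ∈ T K, (shB K t τ + exp (c - r) * shA K t τ) ≤ Wsh K * ∑ τ ∈ T K, B K t τ + exp (c - r) * (Wsh K * ∑ τ ∈ T K, A K t τ) := by
    rw [Finset.sum_add_distrib, ← Finset.mul_sum]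
    exact add_le_add (hSh.right K t ht) (mul_le_mul_of_nonneg_left (hSh.left K t ht) (exp_pos _).le)
  have hbadW : ∑ τ ∈ Bad K t, (B K t τ + exp (c - r) * A K t τ) ≤ W K * ∑ τ ∈ T K, B K t τ + exp (c - r) * (W K * ∑ τ ∈ T K, A K t τ) := by
    rw [Finset.sum_add_distrib, ← Finset.mul_sum]
    exact add_le_add (hW.bad_right K t ht) (mul_le_mul_of_nonneg_left (hW.bad_left K t ht) (exp_pos _).le)
  have := add_le_add (hgood.trans hshell) (hbad.trans hbadW)
  linarith [this]

end Upper

/-! ## §2  Under a D-QUANTISED log-ratio with an ANTI-CONCENTRATED label the misfit is LARGE for every window centre `c` -/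

section Lower

variable {ι : Type*} {T : Finset ι} {A B : ι → ℝ} {v : ι → ℤ} {c₀ D ε c r m : ℝ}

/-- [folklore] Two integer labels whose lattice values `c₀ + D·v` both lie within `R` of a centre, `2R < D`, are EQUAL (one lattice level per window). -/
theorem label_eq_of_window (hD : 0 < D) {R : ℝ} (hR : 2 * R < D) {z z₀ : ℤ}
    (hz : |c₀ + D * (z : ℝ) - c| ≤ R) (hz₀ : |c₀ + D * (z₀ : ℝ) - c| ≤ R) : z = z₀ := by
  have h1 : |D * ((z : ℝ) - z₀)| ≤ 2 * R := by
    rw [show D * ((z : ℝ) - z₀) = (c₀ + D * (z : ℝ) - c) - (c₀ + D * (z₀ : ℝ) - c) by ring]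
    exact (abs_sub _ _).trans (by linarith)
  have h2 : |((z - z₀ : ℤ) : ℝ)| < 1 := by
    rw [abs_mul, abs_of_pos hD] at h1
    simpa [Int.cast_sub] using lt_of_mul_lt_mul_left (show D * |(z : ℝ) - z₀| < D * 1 by linarith) hD.le
  have h6 : z - z₀ = 0 := Int.abs_lt_one_iff.mp (by exact_mod_cast h2)
  omega

/-- [folklore] **ONE LEVEL IN THE WINDOW**: under anti-concentration (no label level carries more than the fraction `m` of `Σ_T A`, `A ≥ 0`), the classes whose lattice
value lies within `R` of the centre (`2R < D`) carry at most `m·Σ_T A`. -/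
theorem sum_window_le_of_antiConc [DecidableEq ι] (hD : 0 < D) {R : ℝ} (hR : 2 * R < D) (hm : 0 ≤ m) (hA : ∀ τ ∈ T, 0 ≤ A τ)
    (hAC : ∀ n : ℤ, ∑ τ ∈ T.filter (fun τ => v τ = n), A τ ≤ m * ∑ τ ∈ T, A τ) :
    ∑ τ ∈ T.filter (fun τ => |c₀ + D * (v τ : ℝ) - c| ≤ R), A τ ≤ m * ∑ τ ∈ T, A τ := by
  by_cases hne : (T.filter (fun τ => |c₀ + D * (v τ : ℝ) - c| ≤ R)).Nonempty
  · obtain ⟨τ₀, hτ₀⟩ := hne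
    have hτ₀' := (Finset.mem_filter.mp hτ₀).2
    refine le_trans ?_ (hAC (v τ₀))
    refine Finset.sum_le_sum_of_subset_of_nonneg (fun τ hτ => ?_) fun τ hτ _ => hA τ (Finset.mem_filter.mp hτ).1
    have hτ' := Finset.mem_filter.mp hτ
    exact Finset.mem_filter.mpr ⟨hτ'.1, label_eq_of_window hD hR hτ'.2 hτ₀'⟩
  · rw [Finset.not_nonempty_iff_eq_empty.mp hne, Finset.sum_empty]
    exact mul_nonneg hm (Finset.sum_nonneg hA)

/-- [folklore] **POINTWISE**: outside the window of radius `R = r + ε + D∕4` around `c` a class pays at least the fraction `1 − e^{−D∕4}` of `B` (above) or of `e^{c−r}A` (below);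
so `(1 − e^{−D∕4})·(B + e^{c−r}A) ≤ 2·misfit + 𝟙_window·(1 − e^{−D∕4})(B + e^{c−r}A)` on every class. -/
theorem pointwise_lower (hr : 0 ≤ r) (hD : 0 < D) {τ : ι} (hA : 0 ≤ A τ)
    (hQ : exp (c₀ + D * (v τ : ℝ) - ε) * A τ ≤ B τ ∧ B τ ≤ exp (c₀ + D * (v τ : ℝ) + ε) * A τ) :
    (1 - exp (-(D / 4))) * (B τ + exp (c - r) * A τ) ≤
      2 * (max (B τ - exp (c + r) * A τ) 0 + max (exp (c - r) * A τ - B τ) 0) +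
        (if |c₀ + D * (v τ : ℝ) - c| ≤ r + ε + D / 4 then (1 - exp (-(D / 4))) * (B τ + exp (c - r) * A τ) else 0) := by
  have he1 : exp (-(D / 4)) ≤ 1 := exp_le_one_iff.mpr (by linarith)
  have hB0 : 0 ≤ B τ := le_trans (mul_nonneg (exp_pos _).le hA) hQ.1
  have heA : 0 ≤ exp (c - r) * A τ := mul_nonneg (exp_pos _).le hA
  have hm1 : B τ - exp (c + r) * A τ ≤ max (B τ - exp (c + r) * A τ) 0 := le_max_left _ _
  have hm2 : exp (c - r) * A τ - B τ ≤ max (exp (c - r) * A τ - B τ) 0 := le_max_left _ _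
  have hm1' : 0 ≤ max (B τ - exp (c + r) * A τ) 0 := le_max_right _ _
  have hm2' : 0 ≤ max (exp (c - r) * A τ - B τ) 0 := le_max_right _ _
  split_ifs with hmid
  · linarith
  rw [add_zero]
  have hgt : r + ε + D / 4 < |c₀ + D * (v τ : ℝ) - c| := lt_of_not_ge hmid
  rcases le_or_gt (c₀ + D * (v τ : ℝ) - c) 0 with hneg | hpos
  · -- BELOW the window: `B ≤ e^{u+ε}A ≤ e^{−D∕4}·e^{c−r}A`, so the lower misfit is `≥ (1 − e^{−D∕4})·e^{c−r}A ≥ (1 − e^{−D∕4})·B`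
    have hu : c₀ + D * (v τ : ℝ) + ε ≤ c - r + -(D / 4) := by rw [abs_of_nonpos hneg] at hgt; linarith
    have hBle : B τ ≤ exp (-(D / 4)) * (exp (c - r) * A τ) :=
      calc B τ ≤ exp (c₀ + D * (v τ : ℝ) + ε) * A τ := hQ.2
        _ ≤ exp (c - r + -(D / 4)) * A τ := mul_le_mul_of_nonneg_right (exp_le_exp.mpr hu) hA
        _ = exp (-(D / 4)) * (exp (c - r) * A τ) := by rw [exp_add]; ring
    have h1 : (1 - exp (-(D / 4))) * (B τ + exp (c - r) * A τ) ≤ (1 - exp (-(D / 4))) * ((1 + exp (-(D / 4))) * (exp (c - r) * A τ)) :=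
      mul_le_mul_of_nonneg_left (by linarith) (sub_nonneg.mpr he1)
    have h2 : (1 - exp (-(D / 4))) * ((1 + exp (-(D / 4))) * (exp (c - r) * A τ)) ≤ 2 * ((1 - exp (-(D / 4))) * (exp (c - r) * A τ)) := by
      nlinarith [mul_nonneg (sub_nonneg.mpr he1) heA]
    have h3 : (1 - exp (-(D / 4))) * (exp (c - r) * A τ) ≤ exp (c - r) * A τ - B τ := by linarith
    linarith
  · -- ABOVE the window: `B ≥ e^{u−ε}A ≥ e^{D∕4}·e^{c+r}A`, so the upper misfit is `≥ (1 − e^{−D∕4})·B ≥ (1 − e^{−D∕4})·e^{c−r}A`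
    have hu : c + r + D / 4 ≤ c₀ + D * (v τ : ℝ) - ε := by rw [abs_of_pos hpos] at hgt; linarith
    have hBge : exp (D / 4) * (exp (c + r) * A τ) ≤ B τ :=
      calc exp (D / 4) * (exp (c + r) * A τ) = exp (c + r + D / 4) * A τ := by simp only [exp_add]; ring
        _ ≤ exp (c₀ + D * (v τ : ℝ) - ε) * A τ := mul_le_mul_of_nonneg_right (exp_le_exp.mpr hu) hA
        _ ≤ B τ := hQ.1
    have hkey : exp (c + r) * A τ ≤ exp (-(D / 4)) * B τ := by
      have h := mul_le_mul_of_nonneg_left hBge (exp_pos (-(D / 4))).le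
      rw [← mul_assoc, ← exp_add, show -(D / 4) + D / 4 = 0 by ring, exp_zero, one_mul] at h; exact h
    have hlow : exp (c - r) * A τ ≤ B τ :=
      calc exp (c - r) * A τ ≤ exp (c + r + D / 4) * A τ := mul_le_mul_of_nonneg_right (exp_le_exp.mpr (by linarith)) hA
        _ = exp (D / 4) * (exp (c + r) * A τ) := by simp only [exp_add]; ring
        _ ≤ B τ := hBge
    have h1 : (1 - exp (-(D / 4))) * (B τ + exp (c - r) * A τ) ≤ (1 - exp (-(D / 4))) * (2 * B τ) :=
      mul_le_mul_of_nonneg_left (by linarith) (sub_nonneg.mpr he1)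
    have h2 : (1 - exp (-(D / 4))) * B τ ≤ B τ - exp (c + r) * A τ := by linarith
    linarith

/-- ★ **THE MISFIT IS LARGE UNDER (Q) ∧ (ACn)** [folklore]: if on the class set the two-run log-ratio is D-quantised along the integer label `v` up to `ε`
(`e^{c₀ + D·v − ε}A ≤ B ≤ e^{c₀ + D·v + ε}A`), no label level carries more than the fraction `m` of `Σ_T A`, `A ≥ 0`, and the window half-width satisfies `r + ε < D∕4`,
then for EVERY centre `c`: `(1 − e^{−D∕4})·(1 − m(1 + e^{3D∕4}))∕2 · (Σ_T B + e^{c−r}Σ_T A) ≤ Σ_T misfit(c, r)`. -/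
theorem sum_misfit_ge_of_quantised_antiConc [DecidableEq ι] (hD : 0 < D) (hr : 0 ≤ r) (hwin : r + ε < D / 4) (hm : 0 ≤ m)
    (hA : ∀ τ ∈ T, 0 ≤ A τ)
    (hQ : ∀ τ ∈ T, exp (c₀ + D * (v τ : ℝ) - ε) * A τ ≤ B τ ∧ B τ ≤ exp (c₀ + D * (v τ : ℝ) + ε) * A τ)
    (hAC : ∀ n : ℤ, ∑ τ ∈ T.filter (fun τ => v τ = n), A τ ≤ m * ∑ τ ∈ T, A τ) :
    (1 - exp (-(D / 4))) * ((1 - m * (1 + exp (3 * D / 4))) / 2) * (∑ τ ∈ T, B τ + exp (c - r) * ∑ τ ∈ T, A τ) ≤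
      ∑ τ ∈ T, (max (B τ - exp (c + r) * A τ) 0 + max (exp (c - r) * A τ - B τ) 0) := by
  have hg0 : 0 ≤ 1 - exp (-(D / 4)) := by linarith [exp_le_one_iff.mpr (show -(D / 4) ≤ 0 by linarith)]
  have hR : 2 * (r + ε + D / 4) < D := by linarith
  have hpt := Finset.sum_le_sum fun τ (hτ : τ ∈ T) => pointwise_lower (c := c) (r := r) hr hD (hA τ hτ) (hQ τ hτ)
  have hL : ∑ τ ∈ T, (1 - exp (-(D / 4))) * (B τ + exp (c - r) * A τ) =
      (1 - exp (-(D / 4))) * (∑ τ ∈ T, B τ + exp (c - r) * ∑ τ ∈ T, A τ) := by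
    rw [← Finset.mul_sum, Finset.sum_add_distrib, Finset.mul_sum]
  have hRs : ∑ τ ∈ T, (2 * (max (B τ - exp (c + r) * A τ) 0 + max (exp (c - r) * A τ - B τ) 0) +
        (if |c₀ + D * (v τ : ℝ) - c| ≤ r + ε + D / 4 then (1 - exp (-(D / 4))) * (B τ + exp (c - r) * A τ) else 0)) =
      2 * ∑ τ ∈ T, (max (B τ - exp (c + r) * A τ) 0 + max (exp (c - r) * A τ - B τ) 0) +
        ∑ τ ∈ T.filter (fun τ => |c₀ + D * (v τ : ℝ) - c| ≤ r + ε + D / 4), (1 - exp (-(D / 4))) * (B τ + exp (c - r) * A τ) := by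
    rw [Finset.sum_add_distrib, ← Finset.mul_sum, Finset.sum_filter]
  -- the window classes: B + e^{c-r}A ≤ (1 + e^{3D/4}) e^{c-r} A there, and they carry ≤ m Σ_T A
  have hmidpt : ∀ τ ∈ T.filter (fun τ => |c₀ + D * (v τ : ℝ) - c| ≤ r + ε + D / 4),
      (1 - exp (-(D / 4))) * (B τ + exp (c - r) * A τ) ≤ (1 - exp (-(D / 4))) * ((1 + exp (3 * D / 4)) * (exp (c - r) * A τ)) := by
    intro τ hτ
    obtain ⟨hτT, hτw⟩ := Finset.mem_filter.mp hτ
    refine mul_le_mul_of_nonneg_left ?_ hg0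
    have hu : c₀ + D * (v τ : ℝ) + ε ≤ c - r + (2 * r + 2 * ε + D / 4) := by linarith [(abs_le.mp hτw).2]
    have h34 : 2 * r + 2 * ε + D / 4 ≤ 3 * D / 4 := by linarith
    have hB : B τ ≤ exp (3 * D / 4) * (exp (c - r) * A τ) :=
      calc B τ ≤ exp (c₀ + D * (v τ : ℝ) + ε) * A τ := (hQ τ hτT).2
        _ ≤ exp (c - r + (2 * r + 2 * ε + D / 4)) * A τ := mul_le_mul_of_nonneg_right (exp_le_exp.mpr hu) (hA τ hτT)
        _ = exp (2 * r + 2 * ε + D / 4) * (exp (c - r) * A τ) := by rw [exp_add]; ring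
        _ ≤ exp (3 * D / 4) * (exp (c - r) * A τ) := mul_le_mul_of_nonneg_right (exp_le_exp.mpr h34) (mul_nonneg (exp_pos _).le (hA τ hτT))
    linarith
  have hmid : ∑ τ ∈ T.filter (fun τ => |c₀ + D * (v τ : ℝ) - c| ≤ r + ε + D / 4), (1 - exp (-(D / 4))) * (B τ + exp (c - r) * A τ) ≤
      (1 - exp (-(D / 4))) * ((1 + exp (3 * D / 4)) * (exp (c - r) * (m * ∑ τ ∈ T, A τ))) := by
    refine (Finset.sum_le_sum hmidpt).trans ?_
    rw [← Finset.mul_sum, ← Finset.mul_sum, ← Finset.mul_sum]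
    exact mul_le_mul_of_nonneg_left (mul_le_mul_of_nonneg_left
      (mul_le_mul_of_nonneg_left (sum_window_le_of_antiConc (c₀ := c₀) (c := c) hD hR hm hA hAC) (exp_pos _).le)
      (by positivity)) hg0
  have hSB : 0 ≤ ∑ τ ∈ T, B τ := Finset.sum_nonneg fun τ hτ => le_trans (mul_nonneg (exp_pos _).le (hA τ hτ)) (hQ τ hτ).1
  have he : 0 < exp (c - r) := exp_pos _
  have h1 : (1 - exp (-(D / 4))) * (∑ τ ∈ T, B τ + exp (c - r) * ∑ τ ∈ T, A τ) ≤
      2 * ∑ τ ∈ T, (max (B τ - exp (c + r) * A τ) 0 + max (exp (c - r) * A τ - B τ) 0) +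
        (1 - exp (-(D / 4))) * ((1 + exp (3 * D / 4)) * (exp (c - r) * (m * ∑ τ ∈ T, A τ))) := by
    rw [← hL]; exact hpt.trans (hRs.le.trans (by linarith [hmid]))
  have h3 : exp (c - r) * (m * ∑ τ ∈ T, A τ) ≤ m * (∑ τ ∈ T, B τ + exp (c - r) * ∑ τ ∈ T, A τ) := by
    nlinarith [mul_nonneg hm hSB]
  have h4 : (1 - exp (-(D / 4))) * ((1 + exp (3 * D / 4)) * (exp (c - r) * (m * ∑ τ ∈ T, A τ))) ≤
      (1 - exp (-(D / 4))) * ((1 + exp (3 * D / 4)) * (m * (∑ τ ∈ T, B τ + exp (c - r) * ∑ τ ∈ T, A τ))) :=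
    mul_le_mul_of_nonneg_left (mul_le_mul_of_nonneg_left h3 (by positivity)) hg0
  nlinarith [h1, h4, hg0]

end Lower

/-! ## §3  NO DIAL RESCUES THE CORE EDGE: every bad class, shell split, weight and rate sequence fails together -/

section NoRescue

variable {ι : Type*} [DecidableEq ι] {l₀ vol : ℝ} {T : ℕ → Finset ι} {A B : ℕ → ℝ → ι → ℝ}
  {v : ℕ → ℝ → ι → ℤ} {c₀ : ℕ → ℝ → ℝ} {D ε m : ℝ}

/-- ★★ **NO DIAL RESCUES THE FACES** [folklore]: suppose that FREQUENTLY in `K` some admissible source `|t| ≤ l₀` has positive total run-A weight, non-negative run-A weights,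
(Q) a two-run log-ratio D-QUANTISED along an integer class label up to `ε < D∕4` — `e^{c₀ + D·v_τ − ε}A_τ ≤ B_τ ≤ e^{c₀ + D·v_τ + ε}A_τ` on the class set — and (ACn) the label
ANTI-CONCENTRATED under the run-A weights — no level carries more than `m·Σ_T A`, `m(1 + e^{3D∕4}) ≤ 1∕2`.  Then for EVERY bad class `Bad` with weights `W` (`RelWeightBound`)
and EVERY shell split `shA, shB` with weights `Wsh` (`ShellWeightBound`) there is NO rate `δ` with `NE7.Core` on the cores AND `Summable δ`: the binders would pay a misfit
`≤ (W_K + Wsh_K)·S` (§1) that (Q) ∧ (ACn) force to be `≥ ¼(1 − e^{−D∕4})·S` (§2) once `|vol·δ_K| + ε < D∕4`, while `W_K + Wsh_K → 0`.  No `W + Wsh < 1` clause is used. -/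
theorem not_coreEdge_of_quantised_antiConc (hD : 0 < D) (hεD : ε < D / 4) (hm : 0 ≤ m) (hm2 : m * (1 + exp (3 * D / 4)) ≤ 1 / 2)
    (hfreq : ∃ᶠ K in atTop, ∃ t : ℝ, |t| ≤ l₀ ∧ 0 < ∑ τ ∈ T K, A K t τ ∧ (∀ τ ∈ T K, 0 ≤ A K t τ) ∧
      (∀ τ ∈ T K, exp (c₀ K t + D * (v K t τ : ℝ) - ε) * A K t τ ≤ B K t τ ∧ B K t τ ≤ exp (c₀ K t + D * (v K t τ : ℝ) + ε) * A K t τ) ∧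
      (∀ n : ℤ, ∑ τ ∈ (T K).filter (fun τ => v K t τ = n), A K t τ ≤ m * ∑ τ ∈ T K, A K t τ))
    {Bad : ℕ → ℝ → Finset ι} {W : ℕ → ℝ} {shA shB : ℕ → ℝ → ι → ℝ} {Wsh : ℕ → ℝ}
    (hW : RelWeightBound l₀ T A B Bad W) (hSh : ShellWeightBound l₀ T A B shA shB Wsh) :
    ¬ ∃ δ : ℕ → ℝ, Core l₀ vol T Bad (fun K t τ => A K t τ - shA K t τ) (fun K t τ => B K t τ - shB K t τ) δ ∧ Summable δ := by
  rintro ⟨δ, hC, hδ⟩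
  have hWt : Tendsto (fun K => W K + Wsh K) atTop (𝓝 0) := by
    simpa using hW.summable.tendsto_atTop_zero.add hSh.summable.tendsto_atTop_zero
  have hδt : Tendsto (fun K => |vol * δ K|) atTop (𝓝 0) := by
    simpa using (hδ.tendsto_atTop_zero.const_mul vol).abs
  have hg0 : 0 < 1 - exp (-(D / 4)) := by linarith [exp_zero ▸ (exp_lt_exp.mpr (show -(D / 4) < 0 by linarith) : exp (-(D / 4)) < exp 0)]
  have hev1 : ∀ᶠ K in atTop, W K + Wsh K < (1 - exp (-(D / 4))) / 4 := (tendsto_order.1 hWt).2 _ (by linarith)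
  have hev2 : ∀ᶠ K in atTop, |vol * δ K| < D / 4 - ε := (tendsto_order.1 hδt).2 _ (by linarith)
  obtain ⟨K, ⟨t, ht, hpos, hA, hQ, hAC⟩, hK1, hK2⟩ := (hfreq.and_eventually (hev1.and hev2)).exists
  obtain ⟨c, hc⟩ := hC K
  have hB : ∀ τ ∈ T K, 0 ≤ B K t τ := fun τ hτ => le_trans (mul_nonneg (exp_pos _).le (hA τ hτ)) (hQ τ hτ).1
  -- the core sandwich with the non-negative half-width |vol δ_K|
  have hcore' : ∀ τ ∈ T K \ Bad K t, exp (c - |vol * δ K|) * (A K t τ - shA K t τ) ≤ B K t τ - shB K t τ ∧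
      B K t τ - shB K t τ ≤ exp (c + |vol * δ K|) * (A K t τ - shA K t τ) := fun τ hτ =>
    sandwich_abs (sub_nonneg.mpr (hSh.sh_le_left K t ht τ (Finset.mem_sdiff.mp hτ).1)) (hc t ht τ hτ)
  have hup := sum_misfit_le_of_faces hW hSh ht hcore' hA hB
  have hlow := sum_misfit_ge_of_quantised_antiConc (T := T K) (A := A K t) (B := B K t) (v := v K t) (c₀ := c₀ K t) (c := c)
    (r := |vol * δ K|) hD (abs_nonneg _) (by linarith) hm hA hQ hAC
  have hS : 0 < ∑ τ ∈ T K, B K t τ + exp (c - |vol * δ K|) * ∑ τ ∈ T K, A K t τ :=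
    add_pos_of_nonneg_of_pos (Finset.sum_nonneg hB) (mul_pos (exp_pos _) hpos)
  have hcoef : (1 - exp (-(D / 4))) / 4 ≤ (1 - exp (-(D / 4))) * ((1 - m * (1 + exp (3 * D / 4))) / 2) := by nlinarith
  have h1 : (1 - exp (-(D / 4))) / 4 * (∑ τ ∈ T K, B K t τ + exp (c - |vol * δ K|) * ∑ τ ∈ T K, A K t τ) ≤
      (W K + Wsh K) * (∑ τ ∈ T K, B K t τ + exp (c - |vol * δ K|) * ∑ τ ∈ T K, A K t τ) :=
    le_trans (le_trans (mul_le_mul_of_nonneg_right hcoef hS.le) hlow) hup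
  have h2 := le_of_mul_le_mul_right h1 hS
  linarith

/-- ★★ **NO DIAL RESCUES `HybridNE7`** [folklore]: under (Q) ∧ (ACn) frequently in `K`, NO choice of bad class, weights, shell split, shell weights and rate assembles
the hybrid binder list `T4MatchingAssembly.HybridNE7` at this reading. -/
theorem not_hybridNE7_of_quantised_antiConc (hD : 0 < D) (hεD : ε < D / 4) (hm : 0 ≤ m) (hm2 : m * (1 + exp (3 * D / 4)) ≤ 1 / 2)
    (hfreq : ∃ᶠ K in atTop, ∃ t : ℝ, |t| ≤ l₀ ∧ 0 < ∑ τ ∈ T K, A K t τ ∧ (∀ τ ∈ T K, 0 ≤ A K t τ) ∧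
      (∀ τ ∈ T K, exp (c₀ K t + D * (v K t τ : ℝ) - ε) * A K t τ ≤ B K t τ ∧ B K t τ ≤ exp (c₀ K t + D * (v K t τ : ℝ) + ε) * A K t τ) ∧
      (∀ n : ℤ, ∑ τ ∈ (T K).filter (fun τ => v K t τ = n), A K t τ ≤ m * ∑ τ ∈ T K, A K t τ)) :
    ¬ ∃ (Bad : ℕ → ℝ → Finset ι) (W : ℕ → ℝ) (shA shB : ℕ → ℝ → ι → ℝ) (Wsh δ : ℕ → ℝ), HybridNE7 l₀ vol T A B Bad W shA shB Wsh δ := by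
  rintro ⟨Bad, W, shA, shB, Wsh, δ, h⟩
  exact not_coreEdge_of_quantised_antiConc hD hεD hm hm2 hfreq h.weight h.shell ⟨δ, h.core, h.summable⟩

/-- [folklore] **SANITY CONVERSE — THE QUANTUM `D` IS THE WHOLE OBSTRUCTION**: if at every level the two-run ratio is ONE class-independent constant
(`B = e^{c_K}·A` on the class set — the `D = 0` ∕ one-level case of (Q)), then with the EMPTY bad class and ZERO shells the core edge holds with rate `δ = 0`. -/
theorem core_of_classConstant_ratio {c : ℕ → ℝ}
    (h : ∀ (K : ℕ) (t : ℝ), |t| ≤ l₀ → ∀ τ ∈ T K, B K t τ = exp (c K) * A K t τ) :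
    Core l₀ vol T (fun _ _ => ∅) (fun K t τ => A K t τ - 0) (fun K t τ => B K t τ - 0) (fun _ => 0) := by
  intro K
  refine ⟨c K, fun t ht τ hτ => ?_⟩
  simp only [sub_zero, mul_zero, add_zero, h K t ht τ (Finset.mem_sdiff.mp hτ).1]
  exact ⟨le_rfl, le_rfl⟩

end NoRescue

/-! ## §4  A6 non-vacuity: the uniform-label toy — every hypothesis jointly inhabited, the conclusion non-vacuous; and the `D = 0` control -/

section Toy

/-- [folklore] **THE TOY IS EXACTLY QUANTISED** (ε = 0, c₀ = 0): classes = old-block counts `0, …, n_K`, run A `≡ 1`, run B `= e^{D·count}`. -/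
theorem toy_quantised (D : ℝ) (m : ℕ) :
    ∀ τ ∈ range (m + 1), exp (0 + D * ((τ : ℤ) : ℝ) - 0) * (1 : ℝ) ≤ exp (D * τ) ∧ exp (D * τ) ≤ exp (0 + D * ((τ : ℤ) : ℝ) + 0) * (1 : ℝ) :=
  fun τ _ => by simp

/-- [folklore] **THE TOY IS ANTI-CONCENTRATED at level `1∕(n_K + 1)`**: each count is carried by exactly one class of unit weight. -/
theorem toy_antiConc (m : ℕ) (z : ℤ) :
    ∑ _τ ∈ (range (m + 1)).filter (fun τ : ℕ => (τ : ℤ) = z), (1 : ℝ) ≤ (1 / ((m : ℝ) + 1)) * ∑ _τ ∈ range (m + 1), (1 : ℝ) := by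
  have hcard : ((range (m + 1)).filter (fun τ : ℕ => (τ : ℤ) = z)).card ≤ 1 :=
    Finset.card_le_one.mpr fun a ha b hb => by exact_mod_cast (Finset.mem_filter.mp ha).2.trans (Finset.mem_filter.mp hb).2.symm
  have h1 : ∑ _τ ∈ (range (m + 1)).filter (fun τ : ℕ => (τ : ℤ) = z), (1 : ℝ) ≤ 1 := by
    rw [Finset.sum_const, nsmul_eq_mul, mul_one]; exact_mod_cast hcard
  have h2 : (1 / ((m : ℝ) + 1)) * ∑ _τ ∈ range (m + 1), (1 : ℝ) = 1 := by
    rw [Finset.sum_const, nsmul_eq_mul, mul_one, Finset.card_range]; push_cast; field_simp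
  rw [h2]; exact h1

/-- ★ **THE TOY ADMITS NO HYBRID BINDER LIST — FOR NO BAD CLASS, NO SHELL SPLIT, NO WEIGHTS, NO RATE** (`D > 0`, `n_K → ∞`, any `l₀ ≥ 0`, any `vol`): the A6 witness
that §3's hypotheses are jointly inhabited and its conclusion bites. -/
theorem not_hybridNE7_toy {D : ℝ} (hD : 0 < D) {n : ℕ → ℕ} (hn : Tendsto n atTop atTop) {l₀ : ℝ} (hl₀ : 0 ≤ l₀) (vol : ℝ) :
    ¬ ∃ (Bad : ℕ → ℝ → Finset ℕ) (W : ℕ → ℝ) (shA shB : ℕ → ℝ → ℕ → ℝ) (Wsh δ : ℕ → ℝ),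
      HybridNE7 l₀ vol (fun K => range (n K + 1)) (fun (_ : ℕ) (_ : ℝ) (_ : ℕ) => (1 : ℝ)) (fun (_ : ℕ) (_ : ℝ) (τ : ℕ) => exp (D * τ)) Bad W shA shB Wsh δ := by
  have hm0 : 0 ≤ 1 / (2 * (1 + exp (3 * D / 4))) := by positivity
  have hm2 : 1 / (2 * (1 + exp (3 * D / 4))) * (1 + exp (3 * D / 4)) ≤ 1 / 2 := by
    rw [div_mul_eq_mul_div, one_mul, div_le_div_iff₀ (by positivity) (by norm_num)]
    linarith [exp_pos (3 * D / 4)]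
  refine not_hybridNE7_of_quantised_antiConc (v := fun (_ : ℕ) (_ : ℝ) (τ : ℕ) => (τ : ℤ)) (c₀ := fun (_ : ℕ) (_ : ℝ) => (0 : ℝ)) (ε := 0)
    hD (by linarith) hm0 hm2 ?_
  -- eventually (hence frequently): the level `1∕(n_K+1)` is below the fixed anti-concentration threshold
  have hev : ∀ᶠ K in atTop, 2 * (1 + exp (3 * D / 4)) ≤ (n K : ℝ) + 1 := by
    have h := (tendsto_natCast_atTop_atTop.comp hn).eventually_ge_atTop (2 * (1 + exp (3 * D / 4)))
    exact h.mono fun K hK => by simp only [Function.comp] at hK; linarith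
  refine hev.frequently.mono fun K hK => ⟨0, by simpa using hl₀, ?_, fun _ _ => zero_le_one, toy_quantised D (n K), fun z => ?_⟩
  · simp only [Finset.sum_const, Finset.card_range, nsmul_eq_mul, mul_one]; positivity
  · exact (toy_antiConc (n K) z).trans (mul_le_mul_of_nonneg_right (one_div_le_one_div_of_le (by positivity) hK) (Finset.sum_nonneg fun _ _ => zero_le_one))

/-- [folklore] **THE `D = 0` CONTROL**: the SAME toy with an UNQUANTISED (class-constant) two-run ratio — run B `≡` run A — carries the hybrid binder list trivially
(empty bad class, zero shells, zero weights, zero rate): the label quantum `D` is the whole obstruction. -/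
theorem hybridNE7_toy_unquantised {l₀ : ℝ} (vol : ℝ) (n : ℕ → ℕ) :
    HybridNE7 l₀ vol (fun K => range (n K + 1)) (fun (_ : ℕ) (_ : ℝ) (_ : ℕ) => (1 : ℝ)) (fun (_ : ℕ) (_ : ℝ) (_ : ℕ) => (1 : ℝ))
      (fun _ _ => ∅) (fun _ => 0) (fun _ _ _ => 0) (fun _ _ _ => 0) (fun _ => 0) (fun _ => 0) where
  weight := { bad_subset := fun _ _ _ => Finset.empty_subset _, nonneg := fun _ => le_rfl, lt_one := fun _ => zero_lt_one, summable := summable_zero,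
              bad_left := fun _ _ _ => by simp, bad_right := fun _ _ _ => by simp }
  shell := { nonneg := fun _ => le_rfl, summable := summable_zero, sh_nonneg_left := fun _ _ _ _ _ => le_rfl, sh_le_left := fun _ _ _ _ _ => zero_le_one,
             sh_nonneg_right := fun _ _ _ _ _ => le_rfl, sh_le_right := fun _ _ _ _ _ => zero_le_one, left := fun _ _ _ => by simp, right := fun _ _ _ => by simp }
  lt_one := fun _ => by norm_num
  summable := summable_zero
  core := fun _ => ⟨0, fun _ _ _ _ => by simp⟩

end Toy
end Summit.QuantumFields.YangMills.BalabanUVNodes.N20QuantisedRatioNoRescue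

end
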